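import Mathlib
import HarnessLib

/-!
# Route RevelationMartingale (line «revelation_martingale» on crux `HistoryTailL`, stmt-QuantumFields-19936) —
# STOUT'S SUPERMARTINGALE IN EXPECTATION FORM: proxy rows ⇒ WINDOWED CENTRED SUB-GAUSSIAN MGF and WINDOWED SECOND MOMENT

Cell `ym3-torus` (YM ladder rung R3 = continuum SU(2) Yang–Mills on the three-torus — a RUNG, NOT the Clay problem: not
d = 4, not infinite volume, not a mass gap), width seat `ym-ust-19936-w3` gen 10; pure-probability companion of
`Theorems/RevelationMartingaleProxyQuadraticVariation.lean` for the registered skeleton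
`Cruxes/HistoryTailL/Lines/revelation_martingale.lean` (v3).  Route-independent (Mathlib only); nothing here proves a
stub, the deciding crux `SubGaussianRevelationL` (stmt-QuantumFields-23082), the crux `HistoryTailL` or a summit statement.

WHAT.  On a probability space with a filtration `ℱ : Filtration ℕ`, a bounded `f` and ADAPTED proxies `σ i ≥ 0` with the
conditional-MGF row `E[exp(l·D_i) | ℱ i] ≤ exp(l²σ_i/2)` a.s. (`D_i = E[f|ℱ (i+1)] − E[f|ℱ i]`):
* `integral_exp_stout_le_one` — Stout's exponential supermartingale in EXPECTATION form:
  `∫ exp(l·(E[f|ℱ n] − E[f|ℱ 0]) − (l²/2)·Σ_{i<n} σ i) ≤ 1` (the landed support item `PredictableHoeffding`,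
  ✓`revelationMartingale_predictableHoeffding_proof`, is its Markov/TAIL reading at `l = t/v ≥ 0`; this file exports the
  integrated supermartingale inequality itself, for every real `l`). [folklore]
* `setIntegral_exp_mul_sub_integral_le` — with `ℱ 0 = ⊥` and `f` `ℱ n`-measurable: the WINDOWED CENTRED MGF
  `∫_{Σ_{i<n} σ i ≤ v} exp(l·(f − ∫ f)) ≤ exp(l²v/2)`, and `…_of_window` on any event a.s. inside `{Σ σ ≤ v}`. [folklore]
* `setIntegral_sq_sub_integral_le` — if the rows hold at `l = ±√(2/v)` (`v > 0`): the WINDOWED SECOND MOMENT about the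
  GLOBAL mean `∫_{Σ σ ≤ v} (f − ∫ f)² ≤ e·v`, and `…_of_window`. [folklore]
USE (line card of «revelation_martingale», instrument row «`R_j(K) = Var_W(dist1(Ū^j(∂p)))/g_(K−j)²` K-flat»): the two
bond-revelation stubs give the rows for EVERY real `s` with `Σ σ ≤ Cv·g_(K−j)²` on the first-exit window `W`, hence
(sibling file `RevelationMartingaleWindowedQVOfSubGaussianRevelation.lean`, BY NAME) a windowed centred sub-Gaussian MGF
at scale `g_(K−j)` and `∫_W (f − E f)² ≤ e·Cv·g_(K−j)²`, K-uniformly — a bound a PLAIN Monte-Carlo run can test (no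
nested conditional sampling).  Necessary conditions only. [folklore]
-/

namespace Summit.QuantumFields.YangMills.Theorems.RevelationMartingaleStout

open scoped BigOperators Classical MeasureTheory
open Filter MeasureTheory

variable {Ω : Type*} {mΩ : MeasurableSpace Ω} {μ : Measure Ω} [IsProbabilityMeasure μ]

/-- **STOUT'S EXPONENTIAL SUPERMARTINGALE, EXPECTATION FORM.**  Along a filtration `ℱ : Filtration ℕ`, for a bounded `f`
(`|f| ≤ B`), adapted proxies `σ i ≥ 0` and a real `l` with the one-step rows
`μ[exp(l·(μ[f|ℱ (i+1)] − μ[f|ℱ i])) ∣ ℱ i] ≤ exp(l²·σ i/2)` a.e., the process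
`Z k = exp(l·(μ[f|ℱ k] − μ[f|ℱ 0]) − (l²/2)·Σ_{i<k} σ i)` has `∫ Z n ≤ 1` for every `n` (pull-out property + the row give
`μ[Z (k+1) ∣ ℱ k] ≤ Z k` a.e.; `Z 0 = 1`). [cite: DeLaPenaLaiShao2009, Thm 9.18 pp.102-103] -/
theorem integral_exp_stout_le_one (ℱ : Filtration ℕ mΩ) {f : Ω → ℝ} {B : ℝ} (hfB : ∀ ω, |f ω| ≤ B)
    {σ : ℕ → Ω → ℝ} (hσm : ∀ i, StronglyMeasurable[ℱ i] (σ i)) (hσ0 : ∀ i ω, 0 ≤ σ i ω) (l : ℝ)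
    (hmgf : ∀ i : ℕ, μ[fun ω => Real.exp (l * ((μ[f|ℱ (i + 1)]) ω - (μ[f|ℱ i]) ω)) | ℱ i]
      ≤ᵐ[μ] fun ω => Real.exp (l ^ 2 * σ i ω / 2)) (n : ℕ) :
    ∫ ω, Real.exp (l * ((μ[f|ℱ n]) ω - (μ[f|ℱ 0]) ω) - l ^ 2 / 2 * ∑ i ∈ Finset.range n, σ i ω) ∂μ ≤ 1 := by
  have hfB' : ∀ᵐ ω ∂μ, |f ω| ≤ B := Eventually.of_forall hfB
  have hM_bdd : ∀ k, ∀ᵐ ω ∂μ, |(μ[f|ℱ k]) ω| ≤ B := fun k => ae_bdd_abs_condExp_of_ae_bdd_abs hfB'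
  have hM_sm : ∀ k, StronglyMeasurable[ℱ k] (μ[f|ℱ k]) := fun k => stronglyMeasurable_condExp
  have hV0 : ∀ k ω, 0 ≤ ∑ i ∈ Finset.range k, σ i ω := fun k ω => Finset.sum_nonneg fun i _ => hσ0 i ω
  have hV_sm : ∀ k, StronglyMeasurable[ℱ k] (fun ω => ∑ i ∈ Finset.range k, σ i ω) := fun k =>
    Finset.stronglyMeasurable_fun_sum (Finset.range k)
      (fun i hi => (hσm i).mono (ℱ.mono (Finset.mem_range.mp hi).le))
  -- Stout's process
  obtain ⟨Z, hZ⟩ : ∃ Z : ℕ → Ω → ℝ, ∀ k, Z k = fun ω =>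
      Real.exp (l * ((μ[f|ℱ k]) ω - (μ[f|ℱ 0]) ω) - l ^ 2 / 2 * ∑ i ∈ Finset.range k, σ i ω) :=
    ⟨_, fun _ => rfl⟩
  have hZ_pos : ∀ k ω, 0 < Z k ω := fun k ω => by rw [hZ]; exact Real.exp_pos _
  have hZ_sm : ∀ k, StronglyMeasurable[ℱ k] (Z k) := fun k => by
    rw [hZ]
    exact Real.continuous_exp.comp_stronglyMeasurable
      ((((hM_sm k).sub ((hM_sm 0).mono (ℱ.mono (Nat.zero_le k)))).const_mul l).sub
        ((hV_sm k).const_mul (l ^ 2 / 2)))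
  have hZ_bdd : ∀ k, ∀ᵐ ω ∂μ, ‖Z k ω‖ ≤ Real.exp (|l| * (2 * B)) := fun k => by
    filter_upwards [hM_bdd k, hM_bdd 0] with ω hk hk0
    rw [Real.norm_eq_abs, abs_of_pos (hZ_pos k ω), hZ]
    refine Real.exp_le_exp.mpr ?_
    have h1 : |(μ[f|ℱ k]) ω - (μ[f|ℱ 0]) ω| ≤ 2 * B := by
      have := abs_sub ((μ[f|ℱ k]) ω) ((μ[f|ℱ 0]) ω); linarith
    have h2 : l * ((μ[f|ℱ k]) ω - (μ[f|ℱ 0]) ω) ≤ |l| * (2 * B) :=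
      (le_abs_self _).trans (by rw [abs_mul]; exact mul_le_mul_of_nonneg_left h1 (abs_nonneg l))
    have h3 : 0 ≤ l ^ 2 / 2 * ∑ i ∈ Finset.range k, σ i ω := mul_nonneg (by positivity) (hV0 k ω)
    linarith
  have hZ_int : ∀ k, Integrable (Z k) μ := fun k =>
    Integrable.of_bound ((hZ_sm k).mono (ℱ.le k)).aestronglyMeasurable _ (hZ_bdd k)
  -- one supermartingale step, integrated
  have hstep : ∀ k, ∫ ω, Z (k + 1) ω ∂μ ≤ ∫ ω, Z k ω ∂μ := fun k => by
    have hg_sm : StronglyMeasurable[ℱ k] (fun ω => Z k ω * Real.exp (-(l ^ 2 / 2) * σ k ω)) :=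
      (hZ_sm k).mul (Real.continuous_exp.comp_stronglyMeasurable ((hσm k).const_mul (-(l ^ 2 / 2))))
    have hg_nonneg : ∀ ω, 0 ≤ Z k ω * Real.exp (-(l ^ 2 / 2) * σ k ω) := fun ω =>
      mul_nonneg (hZ_pos k ω).le (Real.exp_pos _).le
    have hg_bdd : ∀ᵐ ω ∂μ, ‖Z k ω * Real.exp (-(l ^ 2 / 2) * σ k ω)‖ ≤ Real.exp (|l| * (2 * B)) := by
      filter_upwards [hZ_bdd k] with ω hω
      rw [Real.norm_eq_abs, abs_of_nonneg (hg_nonneg ω)]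
      rw [Real.norm_eq_abs, abs_of_pos (hZ_pos k ω)] at hω
      have h1 : Real.exp (-(l ^ 2 / 2) * σ k ω) ≤ 1 := by
        refine Real.exp_le_one_iff.mpr ?_
        have := hσ0 k ω
        nlinarith [sq_nonneg l]
      calc Z k ω * Real.exp (-(l ^ 2 / 2) * σ k ω) ≤ Z k ω * 1 :=
            mul_le_mul_of_nonneg_left h1 (hZ_pos k ω).le
        _ ≤ Real.exp (|l| * (2 * B)) := by rw [mul_one]; exact hω
    have hh_sm : StronglyMeasurable
        (fun ω' => Real.exp (l * ((μ[f|ℱ (k + 1)]) ω' - (μ[f|ℱ k]) ω'))) :=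
      Real.continuous_exp.comp_stronglyMeasurable
        ((((hM_sm (k + 1)).mono (ℱ.le (k + 1))).sub ((hM_sm k).mono (ℱ.le k))).const_mul l)
    have hh_int : Integrable (fun ω' => Real.exp (l * ((μ[f|ℱ (k + 1)]) ω' - (μ[f|ℱ k]) ω'))) μ := by
      refine Integrable.of_bound hh_sm.aestronglyMeasurable (Real.exp (|l| * (2 * B))) ?_
      filter_upwards [hM_bdd (k + 1), hM_bdd k] with ω hk1 hk
      rw [Real.norm_eq_abs, abs_of_pos (Real.exp_pos _)]
      refine Real.exp_le_exp.mpr ?_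
      have h1 : |(μ[f|ℱ (k + 1)]) ω - (μ[f|ℱ k]) ω| ≤ 2 * B := by
        have := abs_sub ((μ[f|ℱ (k + 1)]) ω) ((μ[f|ℱ k]) ω); linarith
      exact (le_abs_self _).trans (by rw [abs_mul]; exact mul_le_mul_of_nonneg_left h1 (abs_nonneg l))
    have hfac : Z (k + 1) = (fun ω => Z k ω * Real.exp (-(l ^ 2 / 2) * σ k ω)) *
        (fun ω' => Real.exp (l * ((μ[f|ℱ (k + 1)]) ω' - (μ[f|ℱ k]) ω'))) := by
      funext ω
      simp only [hZ, Pi.mul_apply, Finset.sum_range_succ]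
      rw [← Real.exp_add, ← Real.exp_add]
      congr 1
      ring
    have hpull := condExp_stronglyMeasurable_mul_of_bound (ℱ.le k) hg_sm hh_int (Real.exp (|l| * (2 * B))) hg_bdd
    have hce : μ[Z (k + 1)|ℱ k] ≤ᵐ[μ] Z k := by
      rw [hfac]
      filter_upwards [hpull, hmgf k] with ω hω hmg
      rw [hω, Pi.mul_apply]
      calc Z k ω * Real.exp (-(l ^ 2 / 2) * σ k ω) *
              (μ[fun ω' => Real.exp (l * ((μ[f|ℱ (k + 1)]) ω' - (μ[f|ℱ k]) ω'))|ℱ k]) ω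
            ≤ Z k ω * Real.exp (-(l ^ 2 / 2) * σ k ω) * Real.exp (l ^ 2 * σ k ω / 2) :=
              mul_le_mul_of_nonneg_left hmg (hg_nonneg ω)
        _ = Z k ω := by
              rw [mul_assoc, ← Real.exp_add]
              have : -(l ^ 2 / 2) * σ k ω + l ^ 2 * σ k ω / 2 = 0 := by ring
              rw [this, Real.exp_zero, mul_one]
    calc ∫ ω, Z (k + 1) ω ∂μ = ∫ ω, (μ[Z (k + 1)|ℱ k]) ω ∂μ := (integral_condExp (ℱ.le k)).symm
      _ ≤ ∫ ω, Z k ω ∂μ := integral_mono_ae integrable_condExp (hZ_int k) hce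
  have hZ0 : ∫ ω, Z 0 ω ∂μ = 1 := by
    have : Z 0 = fun _ => (1 : ℝ) := by
      funext ω
      simp only [hZ, sub_self, mul_zero, Finset.sum_range_zero, Real.exp_zero]
    rw [this, integral_const, smul_eq_mul, mul_one, probReal_univ]
  have hZle : ∀ k, ∫ ω, Z k ω ∂μ ≤ 1 := by
    intro k
    induction k with
    | zero => exact hZ0.le
    | succ k ih => exact (hstep k).trans ih
  have h := hZle n
  rw [hZ] at h
  exact h

/-- **WINDOWED CENTRED SUB-GAUSSIAN MGF.**  If moreover `ℱ 0 = ⊥` and `f` is `ℱ n`-measurable, then on the event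
`{Σ_{i<n} σ i ≤ v}` the centred exponential moment about the GLOBAL mean is sub-Gaussian at the proxy budget:
`∫_{Σ σ ≤ v} exp(l·(f − ∫ f)) ≤ exp(l²·v/2)` (there `exp(l(f − ∫f)) ≤ Z n · exp(l²v/2)`). [folklore] -/
theorem setIntegral_exp_mul_sub_integral_le (ℱ : Filtration ℕ mΩ) {f : Ω → ℝ} {B : ℝ} (hfB : ∀ ω, |f ω| ≤ B)
    (h0 : ℱ 0 = (⊥ : MeasurableSpace Ω)) {n : ℕ} (hfn : StronglyMeasurable[ℱ n] f)
    {σ : ℕ → Ω → ℝ} (hσm : ∀ i, StronglyMeasurable[ℱ i] (σ i)) (hσ0 : ∀ i ω, 0 ≤ σ i ω) (l : ℝ)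
    (hmgf : ∀ i : ℕ, μ[fun ω => Real.exp (l * ((μ[f|ℱ (i + 1)]) ω - (μ[f|ℱ i]) ω)) | ℱ i]
      ≤ᵐ[μ] fun ω => Real.exp (l ^ 2 * σ i ω / 2)) (v : ℝ) :
    ∫ ω in {ω | ∑ i ∈ Finset.range n, σ i ω ≤ v}, Real.exp (l * (f ω - ∫ x, f x ∂μ)) ∂μ
      ≤ Real.exp (l ^ 2 * v / 2) := by
  have hf_meas : StronglyMeasurable f := hfn.mono (ℱ.le n)
  have hf_int : Integrable f μ :=
    Integrable.of_bound hf_meas.aestronglyMeasurable B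
      (Eventually.of_forall fun ω => by rw [Real.norm_eq_abs]; exact hfB ω)
  have hMn : μ[f|ℱ n] = f := condExp_of_stronglyMeasurable (ℱ.le n) hfn hf_int
  have hM0 : μ[f|ℱ 0] = fun _ => ∫ x, f x ∂μ := by rw [h0]; exact condExp_bot f
  have hstout := integral_exp_stout_le_one ℱ hfB hσm hσ0 l hmgf n
  rw [hMn, hM0] at hstout
  -- abbreviations
  have hV0 : ∀ ω, 0 ≤ ∑ i ∈ Finset.range n, σ i ω := fun ω => Finset.sum_nonneg fun i _ => hσ0 i ω
  have hV_sm : StronglyMeasurable (fun ω => ∑ i ∈ Finset.range n, σ i ω) :=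
    (Finset.stronglyMeasurable_fun_sum (Finset.range n)
      (fun i hi => (hσm i).mono (ℱ.mono (Finset.mem_range.mp hi).le))).mono (ℱ.le n)
  -- the centred variable is bounded by `2B`
  have hmean : |∫ x, f x ∂μ| ≤ B := by
    have h1 : |∫ x, f x ∂μ| ≤ ∫ x, |f x| ∂μ := abs_integral_le_integral_abs
    have h2 : ∫ x, |f x| ∂μ ≤ ∫ _, B ∂μ :=
      integral_mono hf_int.abs (integrable_const B) fun ω => hfB ω
    rw [integral_const, smul_eq_mul, probReal_univ, one_mul] at h2
    exact h1.trans h2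
  have hcb : ∀ ω, |f ω - ∫ x, f x ∂μ| ≤ 2 * B := fun ω => by
    have := abs_sub (f ω) (∫ x, f x ∂μ); linarith [hfB ω]
  -- integrability of the two integrands
  have hE_sm : StronglyMeasurable (fun ω => Real.exp (l * (f ω - ∫ x, f x ∂μ))) :=
    Real.continuous_exp.comp_stronglyMeasurable ((hf_meas.sub stronglyMeasurable_const).const_mul l)
  have hE_int : Integrable (fun ω => Real.exp (l * (f ω - ∫ x, f x ∂μ))) μ := by
    refine Integrable.of_bound hE_sm.aestronglyMeasurable (Real.exp (|l| * (2 * B)))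
      (Eventually.of_forall fun ω => ?_)
    rw [Real.norm_eq_abs, abs_of_pos (Real.exp_pos _), Real.exp_le_exp]
    exact (le_abs_self _).trans (by rw [abs_mul]; exact mul_le_mul_of_nonneg_left (hcb ω) (abs_nonneg l))
  have hZ_sm : StronglyMeasurable (fun ω => Real.exp (l * (f ω - ∫ x, f x ∂μ)
      - l ^ 2 / 2 * ∑ i ∈ Finset.range n, σ i ω)) :=
    Real.continuous_exp.comp_stronglyMeasurable
      (((hf_meas.sub stronglyMeasurable_const).const_mul l).sub (hV_sm.const_mul (l ^ 2 / 2)))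
  have hZ_int : Integrable (fun ω => Real.exp (l * (f ω - ∫ x, f x ∂μ)
      - l ^ 2 / 2 * ∑ i ∈ Finset.range n, σ i ω)) μ := by
    refine Integrable.of_bound hZ_sm.aestronglyMeasurable (Real.exp (|l| * (2 * B)))
      (Eventually.of_forall fun ω => ?_)
    rw [Real.norm_eq_abs, abs_of_pos (Real.exp_pos _), Real.exp_le_exp]
    have h1 : l * (f ω - ∫ x, f x ∂μ) ≤ |l| * (2 * B) :=
      (le_abs_self _).trans (by rw [abs_mul]; exact mul_le_mul_of_nonneg_left (hcb ω) (abs_nonneg l))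
    have h2 : 0 ≤ l ^ 2 / 2 * ∑ i ∈ Finset.range n, σ i ω := mul_nonneg (by positivity) (hV0 ω)
    linarith
  -- on the event, `exp(l(f − ∫f)) ≤ exp(l² v/2) · Z n`
  have hA : MeasurableSet {ω | ∑ i ∈ Finset.range n, σ i ω ≤ v} :=
    measurableSet_le hV_sm.measurable measurable_const
  have hdom : ∀ ω ∈ {ω | ∑ i ∈ Finset.range n, σ i ω ≤ v},
      Real.exp (l * (f ω - ∫ x, f x ∂μ)) ≤ Real.exp (l ^ 2 * v / 2) *
        Real.exp (l * (f ω - ∫ x, f x ∂μ) - l ^ 2 / 2 * ∑ i ∈ Finset.range n, σ i ω) := by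
    intro ω hω
    rw [← Real.exp_add, Real.exp_le_exp]
    have h1 : l ^ 2 / 2 * ∑ i ∈ Finset.range n, σ i ω ≤ l ^ 2 / 2 * v :=
      mul_le_mul_of_nonneg_left hω (by positivity)
    linarith
  calc ∫ ω in {ω | ∑ i ∈ Finset.range n, σ i ω ≤ v}, Real.exp (l * (f ω - ∫ x, f x ∂μ)) ∂μ
      ≤ ∫ ω in {ω | ∑ i ∈ Finset.range n, σ i ω ≤ v}, Real.exp (l ^ 2 * v / 2) *
          Real.exp (l * (f ω - ∫ x, f x ∂μ) - l ^ 2 / 2 * ∑ i ∈ Finset.range n, σ i ω) ∂μ :=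
        setIntegral_mono_on hE_int.integrableOn (hZ_int.const_mul _).integrableOn hA hdom
    _ ≤ ∫ ω, Real.exp (l ^ 2 * v / 2) *
          Real.exp (l * (f ω - ∫ x, f x ∂μ) - l ^ 2 / 2 * ∑ i ∈ Finset.range n, σ i ω) ∂μ :=
        setIntegral_le_integral (hZ_int.const_mul _)
          (Eventually.of_forall fun ω => mul_nonneg (Real.exp_pos _).le (Real.exp_pos _).le)
    _ = Real.exp (l ^ 2 * v / 2) *
          ∫ ω, Real.exp (l * (f ω - ∫ x, f x ∂μ) - l ^ 2 / 2 * ∑ i ∈ Finset.range n, σ i ω) ∂μ :=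
        integral_const_mul _ _
    _ ≤ Real.exp (l ^ 2 * v / 2) * 1 := mul_le_mul_of_nonneg_left hstout (Real.exp_pos _).le
    _ = Real.exp (l ^ 2 * v / 2) := mul_one _

/-- The same on any event `W` that lies a.s. inside `{Σ_{i<n} σ i ≤ v}` (e.g. the first-exit window of the line, on
which the stubs put `Σ σ ≤ Cv·g²`). [folklore] -/
theorem setIntegral_exp_mul_sub_integral_le_of_window (ℱ : Filtration ℕ mΩ) {f : Ω → ℝ} {B : ℝ}
    (hfB : ∀ ω, |f ω| ≤ B) (h0 : ℱ 0 = (⊥ : MeasurableSpace Ω)) {n : ℕ} (hfn : StronglyMeasurable[ℱ n] f)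
    {σ : ℕ → Ω → ℝ} (hσm : ∀ i, StronglyMeasurable[ℱ i] (σ i)) (hσ0 : ∀ i ω, 0 ≤ σ i ω) (l : ℝ)
    (hmgf : ∀ i : ℕ, μ[fun ω => Real.exp (l * ((μ[f|ℱ (i + 1)]) ω - (μ[f|ℱ i]) ω)) | ℱ i]
      ≤ᵐ[μ] fun ω => Real.exp (l ^ 2 * σ i ω / 2)) {v : ℝ} {W : Set Ω}
    (hwin : ∀ᵐ ω ∂μ, ω ∈ W → ∑ i ∈ Finset.range n, σ i ω ≤ v) :
    ∫ ω in W, Real.exp (l * (f ω - ∫ x, f x ∂μ)) ∂μ ≤ Real.exp (l ^ 2 * v / 2) := by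
  have hf_meas : StronglyMeasurable f := hfn.mono (ℱ.le n)
  have hcb : ∀ ω, l * (f ω - ∫ x, f x ∂μ) ≤ |l| * (|f ω| + |∫ x, f x ∂μ|) := fun ω =>
    (le_abs_self _).trans (by rw [abs_mul]; exact mul_le_mul_of_nonneg_left (abs_sub _ _) (abs_nonneg l))
  have hE_int : Integrable (fun ω => Real.exp (l * (f ω - ∫ x, f x ∂μ))) μ := by
    refine Integrable.of_bound
      (Real.continuous_exp.comp_stronglyMeasurable
        ((hf_meas.sub stronglyMeasurable_const).const_mul l)).aestronglyMeasurable
      (Real.exp (|l| * (B + |∫ x, f x ∂μ|))) (Eventually.of_forall fun ω => ?_)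
    rw [Real.norm_eq_abs, abs_of_pos (Real.exp_pos _), Real.exp_le_exp]
    exact (hcb ω).trans (mul_le_mul_of_nonneg_left (by linarith [hfB ω]) (abs_nonneg l))
  calc ∫ ω in W, Real.exp (l * (f ω - ∫ x, f x ∂μ)) ∂μ
      ≤ ∫ ω in {ω | ∑ i ∈ Finset.range n, σ i ω ≤ v}, Real.exp (l * (f ω - ∫ x, f x ∂μ)) ∂μ :=
        setIntegral_mono_set hE_int.integrableOn
          (Eventually.of_forall fun ω => (Real.exp_pos _).le) hwin
    _ ≤ Real.exp (l ^ 2 * v / 2) := setIntegral_exp_mul_sub_integral_le ℱ hfB h0 hfn hσm hσ0 l hmgf v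

/-- **WINDOWED SECOND MOMENT ABOUT THE GLOBAL MEAN.**  If the rows hold at the two values `l = ±√(2/v)` (`v > 0`; in the
use: for every real `s`), then `∫_{Σ_{i<n} σ i ≤ v} (f − ∫ f)² ≤ e·v` — from the even minorant `x² ≤ (e^{lx} + e^{−lx})/l²`
and the windowed MGF at `±l`, `l² = 2/v` (the optimal choice of `l` for the crude constant `e`). [folklore] -/
theorem setIntegral_sq_sub_integral_le (ℱ : Filtration ℕ mΩ) {f : Ω → ℝ} {B : ℝ} (hfB : ∀ ω, |f ω| ≤ B)
    (h0 : ℱ 0 = (⊥ : MeasurableSpace Ω)) {n : ℕ} (hfn : StronglyMeasurable[ℱ n] f)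
    {σ : ℕ → Ω → ℝ} (hσm : ∀ i, StronglyMeasurable[ℱ i] (σ i)) (hσ0 : ∀ i ω, 0 ≤ σ i ω)
    (hmgf : ∀ (i : ℕ) (s : ℝ), μ[fun ω => Real.exp (s * ((μ[f|ℱ (i + 1)]) ω - (μ[f|ℱ i]) ω)) | ℱ i]
      ≤ᵐ[μ] fun ω => Real.exp (s ^ 2 * σ i ω / 2)) {v : ℝ} (hv : 0 < v) :
    ∫ ω in {ω | ∑ i ∈ Finset.range n, σ i ω ≤ v}, (f ω - ∫ x, f x ∂μ) ^ 2 ∂μ ≤ Real.exp 1 * v := by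
  set l : ℝ := Real.sqrt (2 / v) with hl
  have hl2 : l ^ 2 = 2 / v := by rw [hl, Real.sq_sqrt (by positivity)]
  have hlpos : 0 < l := by rw [hl]; exact Real.sqrt_pos.mpr (by positivity)
  have hf_meas : StronglyMeasurable f := hfn.mono (ℱ.le n)
  -- pointwise even minorant: `l²x² ≤ e^{lx} + e^{-lx}` (first two terms of the `cosh` series; `2 ≤ …` dropped)
  have hpt : ∀ ω, (f ω - ∫ x, f x ∂μ) ^ 2 ≤
      l⁻¹ ^ 2 * (Real.exp (l * (f ω - ∫ x, f x ∂μ)) + Real.exp ((-l) * (f ω - ∫ x, f x ∂μ))) := by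
    intro ω
    set y : ℝ := f ω - ∫ x, f x ∂μ
    have hc := sum_le_hasSum (Finset.range 2)
      (fun k _ => div_nonneg (by rw [pow_mul]; positivity) (Nat.cast_nonneg _)) (Real.hasSum_cosh (l * y))
    have h2 : 1 + (l * y) ^ 2 / 2 ≤ Real.cosh (l * y) := by
      simpa [Finset.sum_range_succ, Nat.factorial] using hc
    rw [Real.cosh_eq] at h2
    have h3 : l ^ 2 * y ^ 2 ≤ Real.exp (l * y) + Real.exp (-l * y) := by
      rw [neg_mul]; nlinarith [h2]
    have h4 : l⁻¹ ^ 2 * (l ^ 2 * y ^ 2) = y ^ 2 := by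
      field_simp
    rw [← h4]
    exact mul_le_mul_of_nonneg_left h3 (by positivity)
  -- integrability
  have hE_int : ∀ t : ℝ, Integrable (fun ω => Real.exp (t * (f ω - ∫ x, f x ∂μ))) μ := fun t => by
    refine Integrable.of_bound
      (Real.continuous_exp.comp_stronglyMeasurable
        ((hf_meas.sub stronglyMeasurable_const).const_mul t)).aestronglyMeasurable
      (Real.exp (|t| * (B + |∫ x, f x ∂μ|))) (Eventually.of_forall fun ω => ?_)
    rw [Real.norm_eq_abs, abs_of_pos (Real.exp_pos _), Real.exp_le_exp]
    have h1 : t * (f ω - ∫ x, f x ∂μ) ≤ |t| * (|f ω| + |∫ x, f x ∂μ|) :=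
      (le_abs_self _).trans (by rw [abs_mul]; exact mul_le_mul_of_nonneg_left (abs_sub _ _) (abs_nonneg t))
    exact h1.trans (mul_le_mul_of_nonneg_left (by linarith [hfB ω]) (abs_nonneg t))
  have hS_int : Integrable (fun ω => (f ω - ∫ x, f x ∂μ) ^ 2) μ := by
    refine Integrable.of_bound ((hf_meas.sub stronglyMeasurable_const).pow 2).aestronglyMeasurable
      ((B + |∫ x, f x ∂μ|) ^ 2) (Eventually.of_forall fun ω => ?_)
    rw [Real.norm_eq_abs, abs_pow, ← sq_abs (B + _)]
    refine pow_le_pow_left₀ (abs_nonneg _) (((abs_sub _ _).trans ?_).trans (le_abs_self _)) 2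
    linarith [hfB ω]
  have hup := setIntegral_exp_mul_sub_integral_le ℱ hfB h0 hfn hσm hσ0 l (fun i => hmgf i l) v
  have hdn := setIntegral_exp_mul_sub_integral_le ℱ hfB h0 hfn hσm hσ0 (-l) (fun i => hmgf i (-l)) v
  rw [neg_sq] at hdn
  rw [hl2] at hup hdn
  have hev : (2 / v) * v / 2 = 1 := by field_simp
  rw [hev] at hup hdn
  calc ∫ ω in {ω | ∑ i ∈ Finset.range n, σ i ω ≤ v}, (f ω - ∫ x, f x ∂μ) ^ 2 ∂μ
      ≤ ∫ ω in {ω | ∑ i ∈ Finset.range n, σ i ω ≤ v},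
          l⁻¹ ^ 2 * (Real.exp (l * (f ω - ∫ x, f x ∂μ)) + Real.exp ((-l) * (f ω - ∫ x, f x ∂μ))) ∂μ :=
        setIntegral_mono hS_int.integrableOn (((hE_int l).add (hE_int (-l))).const_mul _).integrableOn hpt
    _ = l⁻¹ ^ 2 * (∫ ω in {ω | ∑ i ∈ Finset.range n, σ i ω ≤ v}, Real.exp (l * (f ω - ∫ x, f x ∂μ)) ∂μ +
          ∫ ω in {ω | ∑ i ∈ Finset.range n, σ i ω ≤ v}, Real.exp ((-l) * (f ω - ∫ x, f x ∂μ)) ∂μ) := by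
        rw [integral_const_mul, integral_add (hE_int l).integrableOn (hE_int (-l)).integrableOn]
    _ ≤ l⁻¹ ^ 2 * (Real.exp 1 + Real.exp 1) := by
        exact mul_le_mul_of_nonneg_left (add_le_add hup hdn) (by positivity)
    _ = Real.exp 1 * v := by
        rw [inv_pow, hl2]; field_simp; ring

/-- The windowed second moment on any event `W` a.s. inside `{Σ_{i<n} σ i ≤ v}`: `∫_W (f − ∫ f)² ≤ e·v`. [folklore] -/
theorem setIntegral_sq_sub_integral_le_of_window (ℱ : Filtration ℕ mΩ) {f : Ω → ℝ} {B : ℝ}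
    (hfB : ∀ ω, |f ω| ≤ B) (h0 : ℱ 0 = (⊥ : MeasurableSpace Ω)) {n : ℕ} (hfn : StronglyMeasurable[ℱ n] f)
    {σ : ℕ → Ω → ℝ} (hσm : ∀ i, StronglyMeasurable[ℱ i] (σ i)) (hσ0 : ∀ i ω, 0 ≤ σ i ω)
    (hmgf : ∀ (i : ℕ) (s : ℝ), μ[fun ω => Real.exp (s * ((μ[f|ℱ (i + 1)]) ω - (μ[f|ℱ i]) ω)) | ℱ i]
      ≤ᵐ[μ] fun ω => Real.exp (s ^ 2 * σ i ω / 2)) {v : ℝ} (hv : 0 < v) {W : Set Ω}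
    (hwin : ∀ᵐ ω ∂μ, ω ∈ W → ∑ i ∈ Finset.range n, σ i ω ≤ v) :
    ∫ ω in W, (f ω - ∫ x, f x ∂μ) ^ 2 ∂μ ≤ Real.exp 1 * v := by
  have hf_meas : StronglyMeasurable f := hfn.mono (ℱ.le n)
  have hS_int : Integrable (fun ω => (f ω - ∫ x, f x ∂μ) ^ 2) μ := by
    refine Integrable.of_bound ((hf_meas.sub stronglyMeasurable_const).pow 2).aestronglyMeasurable
      ((B + |∫ x, f x ∂μ|) ^ 2) (Eventually.of_forall fun ω => ?_)
    rw [Real.norm_eq_abs, abs_pow, ← sq_abs (B + _)]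
    refine pow_le_pow_left₀ (abs_nonneg _) (((abs_sub _ _).trans ?_).trans (le_abs_self _)) 2
    linarith [hfB ω]
  calc ∫ ω in W, (f ω - ∫ x, f x ∂μ) ^ 2 ∂μ
      ≤ ∫ ω in {ω | ∑ i ∈ Finset.range n, σ i ω ≤ v}, (f ω - ∫ x, f x ∂μ) ^ 2 ∂μ :=
        setIntegral_mono_set hS_int.integrableOn (Eventually.of_forall fun ω => sq_nonneg _) hwin
    _ ≤ Real.exp 1 * v := setIntegral_sq_sub_integral_le ℱ hfB h0 hfn hσm hσ0 hmgf hv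

end Summit.QuantumFields.YangMills.Theorems.RevelationMartingaleStout
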